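import Summits.HodgeConjecture.CorCM.Census.DecicWeil23MultiDefect
import HarnessLib

/-!
# ANY NUMBER `r` of `(2,3)`-types over one decic CM field: the generating PARTS of a balanced configuration of
# `E × B₁ × ⋯ × B_r` — conjugate pairs, Weil SIXFOLD parts of `B_m × E`, TENFOLD parts of `B_m × B̄_{m'}`

COR-CM (cell `pub-hodgecm2`), seat b30 gen 24 (2026-08-22); count-neutral own lane DECIC-MULTI, part 3; sequel of
`Census/DecicWeil23Multi{,Defect}.lean` (model, DEFECT LAW).  Bookkeeping definitions (the part predicates) and theorems of a
finite model; no named fact, no geometry, no `sorry`, no `decide`.  The slot-generic twin of `Census/DecicWeil23TripleParts`: same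
predicates and proofs with slots `Fin r`; what is NEW is that the parts are shown balanced at EVERY permutation of the pairs by the
defect law (`balancedM_of_defect`) instead of a sixty-row kernel check against the `A₅` table.

THE PARTS of a configuration `(T, v)`, `v : α → PtM r` (an element of `α` is a coordinate `(copy, embedding)` of a product of copies
of `E, B₁, …, B_r`):
* `IsPairPartM v G` — two points over a conjugate pair of labels `{y, cjM y}` (a divisor weight);
* `IsFivePartM v m b G` — five points, one over each label `(m, a, b)`, `a < 5` (NOT balanced; a half of the next two);
* `IsSixPartM v m b G` — a five part of slot `m`, sign `b` plus ONE point over the curve label `inl b`: a lift of the Weil weight of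
  the SIXFOLD `B_m × E` (`k`-signature `(3,3)`, Markman's realm);
* `IsTenPartM v m m' G` — a five part `(m, +)` plus a five part `(m', −)`: a lift of the Weil weight of the TENFOLD `B_m × B̄_{m'}`.

RESULTS (kernel).  Count functions in evaluated form (`….card_filter_inl/inr`), splittings, selection of five and pair parts from
the counts, and the balance of the three generating parts at every permutation `π` for positions with `#I_m = 2`
(`IsPairPartM.balancedM`, `IsSixPartM.balancedM`, `IsTenPartM.balancedM`).  EXTRACTION and the INDUCTION PRINCIPLE are the sequel
`Census/DecicWeil23MultiExtraction.lean`.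
[cite: Pohlmann1968, Thm 1] [cite: GaoUllmo2025, Thm 3.1] [cite: Milne2020HodgeClassesAV, 1.2 (a) and Thm. 1]
[cite: MoonenZarhin1995Duke, Thm. 2.4] [cite: Gordon1999HodgeAVSurvey, 5.13 (ii), 9.2.2]

## References
* [Pohlmann1968] Ann. of Math. 88 (1968), Thm 1.  [GaoUllmo2025] J. Inst. Math. Jussieu 25 (2025), Thm 3.1.
  [Milne2020HodgeClassesAV] arXiv:2010.08857, 1.2 (a), Thm. 1.  [MoonenZarhin1995Duke] Duke Math. J. 77 (1995), Thm. 2.4.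
  [Gordon1999HodgeAVSurvey] CRM Monogr. 10 (1999), 5.13 (ii), 9.2.2.
-/

namespace Summit.HodgeConjecture.CorCM.Census.DecicWeil23Multi

open Finset

variable {r : ℕ} {α : Type*} {P : Fin r → Fin 5 → Bool} {v : α → PtM r}

/-! ### The parts -/

/-- **A pair part**: two points over a conjugate pair of labels `{y, cjM y}` (a divisor weight, possibly spread over two copies).
[cite: Gordon1999HodgeAVSurvey, 9.2.2] -/
def IsPairPartM (v : α → PtM r) (G : Finset α) : Prop :=
  ∃ y : PtM r, G.card = 2 ∧ Set.InjOn v ↑G ∧ G.image v = {y, cjM y}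

/-- **A five part of slot `m` and sign `b`**: five points, one over each label `(m, a, b)` — the weight of the eigenline
`⋀⁵ H¹(B_m)_b` (NOT a Hodge class; the `B_m`-half of a sixfold or tenfold part). [cite: MoonenZarhin1995Duke, Thm. 2.4] -/
def IsFivePartM (v : α → PtM r) (m : Fin r) (b : Bool) (G : Finset α) : Prop :=
  G.card = 5 ∧ ∀ a : Fin 5, (G.filter fun x => v x = Sum.inr (m, (a, b))).card = 1

/-- **A Weil SIXFOLD part of slot `m` and sign `b`**: six points, one over the curve label `inl b` and one over each `(m, a, b)` —
a lift of the Weil weight of `B_m × E` (`k`-signature `(3,3)`). [cite: MoonenZarhin1995Duke, Thm. 2.4]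
[cite: Gordon1999HodgeAVSurvey, 5.13 (ii)] -/
def IsSixPartM (v : α → PtM r) (m : Fin r) (b : Bool) (G : Finset α) : Prop :=
  G.card = 6 ∧ (G.filter fun x => v x = Sum.inl b).card = 1 ∧ ∀ a : Fin 5, (G.filter fun x => v x = Sum.inr (m, (a, b))).card = 1

/-- **The Weil TENFOLD part of the slots `(m, m')`**: ten points, one over each `(m, a, true)` and one over each `(m', a, false)` —
a lift of the Weil weight of the tenfold `B_m × B̄_{m'}` (`k`-signature `(5,5)`). [cite: MoonenZarhin1995Duke, Thm. 2.4]
[cite: Gordon1999HodgeAVSurvey, 5.13 (ii)] -/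
def IsTenPartM (v : α → PtM r) (m m' : Fin r) (G : Finset α) : Prop :=
  G.card = 10 ∧ (∀ a : Fin 5, (G.filter fun x => v x = Sum.inr (m, (a, true))).card = 1) ∧
    ∀ a : Fin 5, (G.filter fun x => v x = Sum.inr (m', (a, false))).card = 1

/-! ### Count functions -/

/-- The count function of a pair part: `1` on `y` and `cjM y`, `0` elsewhere. [folklore] -/
theorem IsPairPartM.count_eq [DecidableEq α] {G : Finset α} (hG : IsPairPartM v G) : ∃ y : PtM r, ∀ z : PtM r,
    (G.filter fun x => v x = z).card = if z = y ∨ z = cjM y then 1 else 0 := by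
  obtain ⟨y, hcard, hinj, himg⟩ := hG
  refine ⟨y, fun z => ?_⟩
  have hfib : ∀ z, (G.filter fun x => v x = z).card = if z ∈ G.image v then 1 else 0 := by
    intro z
    split_ifs with hz
    · obtain ⟨x, hx, rfl⟩ := Finset.mem_image.1 hz
      rw [Finset.card_eq_one]
      refine ⟨x, Finset.eq_singleton_iff_unique_mem.2 ⟨Finset.mem_filter.2 ⟨hx, rfl⟩, fun x' hx' => ?_⟩⟩
      exact hinj (Finset.mem_of_mem_filter _ hx') hx (Finset.mem_filter.1 hx').2
    · rw [Finset.card_eq_zero, Finset.filter_eq_empty_iff]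
      exact fun x hx hxz => hz (hxz ▸ Finset.mem_image_of_mem v hx)
  rw [hfib z, himg]
  simp only [Finset.mem_insert, Finset.mem_singleton]

/-- The fibres over pairwise distinct labels `f a` (`f` injective) and one further fibre fit into `G`. [folklore] -/
private theorem sum_fibres_add_le (G : Finset α) {f : Fin 5 → PtM r} (hf : Function.Injective f) {z : PtM r}
    (hz : ∀ a, z ≠ f a) :
    ∑ a : Fin 5, (G.filter fun x => v x = f a).card + (G.filter fun x => v x = z).card ≤ G.card := by
  classical
  have hpd : ∀ a ∈ (univ : Finset (Fin 5)), ∀ a' ∈ (univ : Finset (Fin 5)), a ≠ a' →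
      Disjoint (G.filter fun x => v x = f a) (G.filter fun x => v x = f a') :=
    fun a _ a' _ haa => Finset.disjoint_filter.2 fun x _ h1 h2 => haa (hf (h1.symm.trans h2))
  have hdisj : Disjoint ((univ : Finset (Fin 5)).biUnion fun a => G.filter fun x => v x = f a) (G.filter fun x => v x = z) :=
    (Finset.disjoint_biUnion_left _ _ _).2 fun a _ => Finset.disjoint_filter.2 fun x _ h1 h2 => hz a (h2.symm.trans h1)
  rw [← Finset.card_biUnion hpd, ← Finset.card_union_of_disjoint hdisj]
  exact Finset.card_le_card (Finset.union_subset (Finset.biUnion_subset.2 fun a _ => Finset.filter_subset _ _)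
    (Finset.filter_subset _ _))

/-- The labels `(m, a, b)`, `a < 5`, are pairwise distinct. [folklore] -/
theorem inr_injective (m : Fin r) (b : Bool) : Function.Injective fun a : Fin 5 => (Sum.inr (m, (a, b)) : PtM r) :=
  fun a a' h => by simpa using h

/-- The count function of a five part of slot `m`, sign `b`: `1` on the five `(m, a, b)`, `0` elsewhere. [folklore] -/
theorem IsFivePartM.count_eq {m : Fin r} {b : Bool} {G : Finset α} (hG : IsFivePartM v m b G) (z : PtM r) :
    (G.filter fun x => v x = z).card = if ∃ a : Fin 5, z = Sum.inr (m, (a, b)) then 1 else 0 := by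
  classical
  obtain ⟨hcard, hB⟩ := hG
  split_ifs with hz
  · obtain ⟨a, rfl⟩ := hz
    exact hB a
  · push Not at hz
    have hle := sum_fibres_add_le (v := v) G (inr_injective m b) hz
    simp only [hB, Finset.sum_const, Finset.card_univ, Fintype.card_fin, smul_eq_mul, mul_one, hcard] at hle
    omega

/-- The count function of a sixfold part: `1` on `inl b` and on the five `(m, a, b)`, `0` elsewhere. [folklore] -/
theorem IsSixPartM.count_eq {m : Fin r} {b : Bool} {G : Finset α} (hG : IsSixPartM v m b G) (z : PtM r) :
    (G.filter fun x => v x = z).card =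
      if z = Sum.inl b then 1 else if ∃ a : Fin 5, z = Sum.inr (m, (a, b)) then 1 else 0 := by
  classical
  obtain ⟨hcard, hE, hB⟩ := hG
  split_ifs with hz hz'
  · rw [hz]; exact hE
  · obtain ⟨a, rfl⟩ := hz'; exact hB a
  · push Not at hz'
    have hle' : ∑ a : Fin 5, (G.filter fun x => v x = Sum.inr (m, (a, b))).card + (G.filter fun x => v x = z).card +
        (G.filter fun x => v x = Sum.inl b).card ≤ G.card := by
      have hpd : ∀ a ∈ (univ : Finset (Fin 5)), ∀ a' ∈ (univ : Finset (Fin 5)), a ≠ a' →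
          Disjoint (G.filter fun x => v x = Sum.inr (m, (a, b))) (G.filter fun x => v x = Sum.inr (m, (a', b))) :=
        fun a _ a' _ haa => Finset.disjoint_filter.2 fun x _ h1 h2 => haa (inr_injective m b (h1.symm.trans h2))
      have hd1 : Disjoint ((univ : Finset (Fin 5)).biUnion fun a => G.filter fun x => v x = Sum.inr (m, (a, b)))
          (G.filter fun x => v x = z) :=
        (Finset.disjoint_biUnion_left _ _ _).2 fun a _ => Finset.disjoint_filter.2 fun x _ h1 h2 => hz' a (h2.symm.trans h1)
      have hd2 : Disjoint (((univ : Finset (Fin 5)).biUnion fun a => G.filter fun x => v x = Sum.inr (m, (a, b))) ∪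
          (G.filter fun x => v x = z)) (G.filter fun x => v x = Sum.inl b) := by
        rw [Finset.disjoint_union_left]
        refine ⟨(Finset.disjoint_biUnion_left _ _ _).2 fun a _ => Finset.disjoint_filter.2 fun x _ h1 h2 => ?_,
          Finset.disjoint_filter.2 fun x _ h1 h2 => hz (h1.symm.trans h2)⟩
        rw [h1] at h2; exact Sum.inr_ne_inl h2
      rw [← Finset.card_biUnion hpd, ← Finset.card_union_of_disjoint hd1, ← Finset.card_union_of_disjoint hd2]
      exact Finset.card_le_card (Finset.union_subset (Finset.union_subset (Finset.biUnion_subset.2 fun a _ =>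
        Finset.filter_subset _ _) (Finset.filter_subset _ _)) (Finset.filter_subset _ _))
    simp only [hE, hB, Finset.sum_const, Finset.card_univ, Fintype.card_fin, smul_eq_mul, mul_one, hcard] at hle'
    omega

/-! ### Elementary properties of five parts -/

/-- Every point of a five part of slot `m`, sign `b` lies over a label `(m, a, b)`. [folklore] -/
theorem IsFivePartM.exists_eq_inr {m : Fin r} {b : Bool} {G : Finset α} (hG : IsFivePartM v m b G) {x : α} (hx : x ∈ G) :
    ∃ a : Fin 5, v x = Sum.inr (m, (a, b)) := by
  classical
  have hpos : 0 < (G.filter fun x' => v x' = v x).card := Finset.card_pos.2 ⟨x, Finset.mem_filter.2 ⟨hx, rfl⟩⟩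
  rw [hG.count_eq] at hpos
  by_contra h
  rw [if_neg h] at hpos
  exact lt_irrefl 0 hpos

/-- A pair part is non-empty. [folklore] -/
theorem IsPairPartM.nonempty {G : Finset α} (hG : IsPairPartM v G) : G.Nonempty := by
  obtain ⟨_, hcard, -⟩ := hG
  rw [← Finset.card_pos, hcard]; norm_num

/-- The model map is injective on a five part. [folklore] -/
theorem IsFivePartM.injOn {m : Fin r} {b : Bool} {G : Finset α} (hG : IsFivePartM v m b G) : Set.InjOn v ↑G := by
  classical
  intro x hx x' hx' h
  have hle : (G.filter fun y => v y = v x).card ≤ 1 := by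
    rw [hG.count_eq]; split_ifs <;> omega
  exact Finset.card_le_one.1 hle x (Finset.mem_filter.2 ⟨hx, rfl⟩) x' (Finset.mem_filter.2 ⟨hx', h.symm⟩)

/-- A five part is non-empty. [folklore] -/
theorem IsFivePartM.nonempty {m : Fin r} {b : Bool} {G : Finset α} (hG : IsFivePartM v m b G) : G.Nonempty := by
  rw [← Finset.card_pos, hG.1]; norm_num

/-- A five part inside `T` from the counts: one point over each `(m, a, b)`. [folklore] -/
theorem exists_fivePartM_of_counts [DecidableEq α] {T : Finset α} (m : Fin r) (b : Bool)
    (hB : ∀ a : Fin 5, 0 < (T.filter fun x => v x = Sum.inr (m, (a, b))).card) : ∃ G ⊆ T, IsFivePartM v m b G := by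
  have hpick : ∀ a : Fin 5, ∃ x ∈ T, v x = Sum.inr (m, (a, b)) := fun a => by
    obtain ⟨x, hx⟩ := Finset.card_pos.1 (hB a)
    exact ⟨x, (Finset.mem_filter.1 hx).1, (Finset.mem_filter.1 hx).2⟩
  choose pick hpickT hpickv using hpick
  have hpinj : Function.Injective pick := fun a a' h => by
    have e := hpickv a
    rw [h, hpickv a'] at e
    have : a' = a := by simpa using e
    exact this.symm
  refine ⟨univ.image pick, fun x hx => by obtain ⟨a, -, rfl⟩ := Finset.mem_image.1 hx; exact hpickT a, ?_, fun a => ?_⟩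
  · rw [Finset.card_image_of_injective _ hpinj, Finset.card_univ, Fintype.card_fin]
  · rw [Finset.card_eq_one]
    refine ⟨pick a, ?_⟩
    ext x
    simp only [Finset.mem_filter, Finset.mem_image, Finset.mem_univ, true_and, Finset.mem_singleton]
    constructor
    · rintro ⟨⟨a', rfl⟩, hvx⟩
      rw [hpickv a'] at hvx
      have : a' = a := by simpa using hvx
      rw [this]
    · rintro rfl
      exact ⟨⟨a, rfl⟩, hpickv a⟩

/-- A pair part inside `T` from the counts: one point over `y` and one over `cjM y`. [folklore] -/
theorem exists_pairPartM_of_counts [DecidableEq α] {T : Finset α} (y : PtM r)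
    (hy : 0 < (T.filter fun x => v x = y).card) (hcy : 0 < (T.filter fun x => v x = cjM y).card) :
    ∃ G ⊆ T, IsPairPartM v G := by
  obtain ⟨x, hx₀⟩ := Finset.card_pos.1 hy
  obtain ⟨hxT, hx⟩ := Finset.mem_filter.1 hx₀
  obtain ⟨x', hx₀'⟩ := Finset.card_pos.1 hcy
  obtain ⟨hx'T, hx'⟩ := Finset.mem_filter.1 hx₀'
  have hne : x ≠ x' := by
    intro h
    apply cjM_ne y
    rw [← hx', ← h, hx]
  refine ⟨{x, x'}, ?_, y, Finset.card_pair hne, ?_, ?_⟩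
  · intro z hz
    rcases Finset.mem_insert.1 hz with rfl | hz
    · exact hxT
    · rw [Finset.mem_singleton.1 hz]; exact hx'T
  · intro z hz z' hz' hzz'
    simp only [Finset.coe_insert, Finset.coe_singleton, Set.mem_insert_iff, Set.mem_singleton_iff] at hz hz'
    rcases hz with rfl | rfl <;> rcases hz' with rfl | rfl
    · rfl
    · exfalso; rw [hx, hx'] at hzz'; exact cjM_ne y hzz'.symm
    · exfalso; rw [hx, hx'] at hzz'; exact cjM_ne y hzz'
    · rfl
  · rw [Finset.image_insert, Finset.image_singleton, hx, hx']

/-! ### Splitting the sixfold and tenfold parts -/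

/-- A sixfold part is its curve point plus a five part. [folklore] -/
theorem IsSixPartM.exists_split [DecidableEq α] {m : Fin r} {b : Bool} {G : Finset α} (hG : IsSixPartM v m b G) :
    ∃ (x : α) (G₁ : Finset α), x ∉ G₁ ∧ G = insert x G₁ ∧ v x = Sum.inl b ∧ IsFivePartM v m b G₁ := by
  obtain ⟨x, hxf⟩ := Finset.card_eq_one.1 hG.2.1
  have hx : x ∈ G.filter fun x => v x = Sum.inl b := by rw [hxf]; exact Finset.mem_singleton_self x
  obtain ⟨hxG, hvx⟩ := Finset.mem_filter.1 hx
  obtain ⟨W, hW, hW'⟩ := exists_fivePartM_of_counts (v := v) (T := G) m b fun a => by rw [hG.2.2 a]; exact one_pos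
  have hxW : x ∉ W := fun h => by
    obtain ⟨a, ha⟩ := hW'.exists_eq_inr h
    rw [hvx] at ha; exact Sum.inl_ne_inr ha
  refine ⟨x, W, hxW, ?_, hvx, hW'⟩
  symm
  apply Finset.eq_of_subset_of_card_le (Finset.insert_subset hxG hW)
  rw [Finset.card_insert_of_notMem hxW, hW'.1, hG.1]

/-- A tenfold part is two five parts: slot `m`, sign `true` and slot `m'`, sign `false`. [folklore] -/
theorem IsTenPartM.exists_split [DecidableEq α] {m m' : Fin r} {G : Finset α} (hG : IsTenPartM v m m' G) :
    ∃ G₀ G₁ : Finset α, Disjoint G₀ G₁ ∧ G = G₀ ∪ G₁ ∧ IsFivePartM v m true G₀ ∧ IsFivePartM v m' false G₁ := by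
  obtain ⟨W₀, hW₀, hW₀'⟩ := exists_fivePartM_of_counts (v := v) (T := G) m true fun a => by rw [hG.2.1 a]; exact one_pos
  obtain ⟨W₁, hW₁, hW₁'⟩ := exists_fivePartM_of_counts (v := v) (T := G) m' false fun a => by rw [hG.2.2 a]; exact one_pos
  have hW : Disjoint W₀ W₁ := by
    rw [Finset.disjoint_left]
    intro x hx0 hx1
    obtain ⟨a, ha⟩ := hW₀'.exists_eq_inr hx0
    obtain ⟨a', ha'⟩ := hW₁'.exists_eq_inr hx1
    have := ha.symm.trans ha'
    simp at this
  refine ⟨W₀, W₁, hW, ?_, hW₀', hW₁'⟩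
  symm
  apply Finset.eq_of_subset_of_card_le (Finset.union_subset hW₀ hW₁)
  rw [Finset.card_union_of_disjoint hW, hW₀'.1, hW₁'.1, hG.1]

/-- The count function of a tenfold part: `1` on the five `(m, a, true)` and the five `(m', a, false)`, `0` elsewhere. [folklore] -/
theorem IsTenPartM.count_eq [DecidableEq α] {m m' : Fin r} {G : Finset α} (hG : IsTenPartM v m m' G) (z : PtM r) :
    (G.filter fun x => v x = z).card =
      if (∃ a : Fin 5, z = Sum.inr (m, (a, true))) ∨ ∃ a : Fin 5, z = Sum.inr (m', (a, false)) then 1 else 0 := by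
  obtain ⟨G₀, G₁, hd, rfl, h₀, h₁⟩ := hG.exists_split
  rw [Finset.filter_union, Finset.card_union_of_disjoint (Finset.disjoint_filter_filter hd), h₀.count_eq, h₁.count_eq]
  by_cases hz0 : ∃ a : Fin 5, z = Sum.inr (m, (a, true))
  · have hz1 : ¬ ∃ a : Fin 5, z = Sum.inr (m', (a, false)) := fun ⟨a, ha⟩ => by
      obtain ⟨a', ha'⟩ := hz0; rw [ha'] at ha; simp at ha
    rw [if_pos hz0, if_neg hz1, if_pos (Or.inl hz0)]
  · by_cases hz1 : ∃ a : Fin 5, z = Sum.inr (m', (a, false))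
    · rw [if_neg hz0, if_pos hz1, if_pos (Or.inr hz1)]
    · rw [if_neg hz0, if_neg hz1, if_neg (fun h => h.elim hz0 hz1)]

/-! ### The count functions in evaluated form -/

/-- A five part: no point over the curve labels. [folklore] -/
theorem IsFivePartM.card_filter_inl {m : Fin r} {b : Bool} {G : Finset α} (hG : IsFivePartM v m b G) (b' : Bool) :
    (G.filter fun x => v x = Sum.inl b').card = 0 := by
  classical
  rw [hG.count_eq, if_neg]
  rintro ⟨a, ha⟩
  exact Sum.inl_ne_inr ha

/-- A five part: one point over `(m, a, b)`, none over the other fivefold labels. [folklore] -/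
theorem IsFivePartM.card_filter_inr {m : Fin r} {b : Bool} {G : Finset α} (hG : IsFivePartM v m b G) (m' : Fin r) (a : Fin 5)
    (b' : Bool) : (G.filter fun x => v x = Sum.inr (m', (a, b'))).card = if m' = m ∧ b' = b then 1 else 0 := by
  classical
  rw [hG.count_eq]
  by_cases h : m' = m ∧ b' = b
  · obtain ⟨rfl, rfl⟩ := h
    rw [if_pos ⟨a, rfl⟩, if_pos ⟨rfl, rfl⟩]
  · rw [if_neg h, if_neg]
    rintro ⟨a', ha'⟩
    simp only [Sum.inr.injEq, Prod.mk.injEq] at ha'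
    exact h ⟨ha'.1, ha'.2.2⟩

/-- A sixfold part is its curve point plus a five part, at the level of counts. [folklore] -/
theorem IsSixPartM.card_filter_eq [DecidableEq α] {m : Fin r} {b : Bool} {G : Finset α} (hG : IsSixPartM v m b G) :
    ∃ G₁ : Finset α, IsFivePartM v m b G₁ ∧ ∀ z : PtM r,
      (G.filter fun x => v x = z).card = (if z = Sum.inl b then 1 else 0) + (G₁.filter fun x => v x = z).card := by
  obtain ⟨x, G₁, hxG₁, rfl, hvx, hG₁⟩ := hG.exists_split
  refine ⟨G₁, hG₁, fun z => ?_⟩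
  rw [Finset.filter_insert, hvx]
  by_cases hz : Sum.inl b = z
  · rw [if_pos hz, if_pos hz.symm, Finset.card_insert_of_notMem fun h => hxG₁ (Finset.mem_of_mem_filter _ h), add_comm]
  · rw [if_neg hz, if_neg (Ne.symm hz), zero_add]

/-! ### The parts are balanced at every permutation -/

section Balanced

variable (P) (hP : ∀ m, ((univ : Finset (Fin 5)).filter fun a => P m a = true).card = 2)

omit hP in
/-- **A pair part is balanced** (its count function is conjugation-invariant, so all defects vanish).
[cite: Gordon1999HodgeAVSurvey, 9.2.2] -/
theorem IsPairPartM.balancedM [DecidableEq α] {G : Finset α} (hG : IsPairPartM v G) (hP : ∀ m, ((univ : Finset (Fin 5)).filter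
    fun a => P m a = true).card = 2) (π : Equiv.Perm (Fin 5)) : 2 * (G.filter fun x => v x ∈ phiM P π).card = G.card := by
  obtain ⟨y, hy⟩ := hG.count_eq
  have hsymm : ∀ z : PtM r, (G.filter fun x => v x = cjM z).card = (G.filter fun x => v x = z).card := by
    intro z
    rw [hy, hy]
    have h1 : cjM z = y ↔ z = cjM y := ⟨fun h => by rw [← h, cjM_cjM], fun h => by rw [h, cjM_cjM]⟩
    have h2 : cjM z = cjM y ↔ z = y := ⟨fun h => by rw [← cjM_cjM z, h, cjM_cjM], fun h => by rw [h]⟩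
    simp only [h1, h2, or_comm]
  refine balancedM_of_defect (P := P) (v := v) hP π (fun _ => 0) (fun m a => ?_) ?_
  · have h := hsymm (Sum.inr (m, (a, true)))
    rw [cjM_inr, Bool.not_true] at h
    rw [h, sub_self]
  · have h := hsymm (Sum.inl true)
    rw [cjM_inl, Bool.not_true] at h
    rw [h, sub_self, Finset.sum_const_zero]

include hP in
/-- **A sixfold part is balanced** (defects `t_{m'} = ±[m' = m]`, `e = ±1`: the Weil class of `B_m × E` is a Hodge class for every
conjugate type). [cite: MoonenZarhin1995Duke, Thm. 2.4] -/
theorem IsSixPartM.balancedM [DecidableEq α] {m : Fin r} {b : Bool} {G : Finset α} (hG : IsSixPartM v m b G)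
    (π : Equiv.Perm (Fin 5)) : 2 * (G.filter fun x => v x ∈ phiM P π).card = G.card := by
  obtain ⟨G₁, hG₁, hcount⟩ := hG.card_filter_eq
  refine balancedM_of_defect (P := P) (v := v) hP π (fun m' => if m' = m then (if b then 1 else -1) else 0) (fun m' a => ?_) ?_
  · rw [hcount, hcount, hG₁.card_filter_inr, hG₁.card_filter_inr, if_neg Sum.inr_ne_inl, if_neg Sum.inr_ne_inl]
    by_cases hm : m' = m
    · rw [if_pos hm]; cases b <;> simp [hm]
    · rw [if_neg hm]; simp [hm]
  · rw [hcount, hcount, hG₁.card_filter_inl, hG₁.card_filter_inl, Finset.sum_ite_eq' Finset.univ m, if_pos (Finset.mem_univ m)]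
    cases b <;> simp

include hP in
/-- **A tenfold part is balanced** (defects `t = [· = m] − [· = m']`, `e = 0`: five of its ten points lie in each `π⁻¹(type)`).
[cite: MoonenZarhin1995Duke, Thm. 2.4] -/
theorem IsTenPartM.balancedM [DecidableEq α] {m m' : Fin r} {G : Finset α} (hG : IsTenPartM v m m' G)
    (π : Equiv.Perm (Fin 5)) : 2 * (G.filter fun x => v x ∈ phiM P π).card = G.card := by
  obtain ⟨G₀, G₁, hd, rfl, h₀, h₁⟩ := hG.exists_split
  have hcount : ∀ z : PtM r, ((G₀ ∪ G₁).filter fun x => v x = z).card =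
      (G₀.filter fun x => v x = z).card + (G₁.filter fun x => v x = z).card := fun z => by
    rw [Finset.filter_union, Finset.card_union_of_disjoint (Finset.disjoint_filter_filter hd)]
  refine balancedM_of_defect (P := P) (v := v) hP π (fun l => (if l = m then 1 else 0) - (if l = m' then 1 else 0))
    (fun l a => ?_) ?_
  · rw [hcount, hcount, h₀.card_filter_inr, h₀.card_filter_inr, h₁.card_filter_inr, h₁.card_filter_inr]
    by_cases hl : l = m <;> by_cases hl' : l = m' <;> simp [hl, hl']
  · rw [hcount, hcount, h₀.card_filter_inl, h₀.card_filter_inl, h₁.card_filter_inl, h₁.card_filter_inl, Finset.sum_sub_distrib,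
      Finset.sum_ite_eq' Finset.univ m, Finset.sum_ite_eq' Finset.univ m', if_pos (Finset.mem_univ _),
      if_pos (Finset.mem_univ _)]
    simp

end Balanced

end Summit.HodgeConjecture.CorCM.Census.DecicWeil23Multi
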